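import Literature.AnabelianGeometry.SemiGraphs.ProSigmaSubquotients
import Literature.AnabelianGeometry.SemiGraphs.Coverticial
import HarnessLib

/-!
# Pro-`Σ` completions restrict to direct summands of abelian groups

[CombGC] Remark 1.3.1 p. 10 speaks of the RANK "over `Ẑ^Σ`" of the closed submodule `M^cusp_G` of
`M_G = Π_G^{ab}`, i.e. (in the tree's rendering `SemiGraphOfAnabelioids.IsProSigmaCompletion`, abc-iut-L3-t1:
"free of rank `r` over `Ẑ^Σ`" = "pro-`Σ` completion of `ℤ^r`") of the closure of the image of a direct
summand of the discrete lattice `Γ^{ab}` inside its pro-`Σ` completion.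
[cite: MochizukiCombGC2007, Rmk 1.3.1 p.10] [cite: MochizukiSemiAnbd2006, Ex. 2.10 p.31]

PROOF-ONLY file (abc-iut cell, layer L3; seat abc-iut-w5-d195 gen 7, toward [CombGC] Rmk. 1.3.1
`CuspRank` at genuine smooth curves).  Plain profinite group theory:

* `IsProSigmaCompletion.restrict_summand` — if `ψ : Λ → A` exhibits the profinite pro-`Σ` group `A` as
  the pro-`Σ` completion of the ABELIAN group `Λ`, and `Λ = L ⊕ L'` (`L ⊔ L' = ⊤`, `L ⊓ L' = ⊥`), then
  `ψ|_L : L → closure(ψ L)` exhibits the closed subgroup `closure(ψ L)` as the pro-`Σ` completion of `L`: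
  dense image by construction; open subgroups of the closed subgroup of a profinite pro-`Σ` group have
  `Σ`-integer index (`IsProSigma.subgroup`); and a `Σ`-index `M ≤ L` is cut out by the open subgroup of `A`
  cutting out `M ⊕ L' ≤ Λ` (same index, `index_sup_eq_of_isCompl`).

0 definitions; nothing here refers to [IUTchIII] Cor. 3.12.
-/

namespace Literature.AnabelianGeometry.SemiGraphs

/-! ### Index bookkeeping in an abelian group `Λ = L ⊕ L'` -/

section Abelian

variable {Λ : Type*} [CommGroup Λ]

/-- In `Λ = L ⊕ L'` (abelian), `L ∩ (K + L') = K` for `K ≤ L` (bookkeeping for the ranks of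
[CombGC] Rmk. 1.3.1). [cite: MochizukiCombGC2007, Rmk 1.3.1 p.10] -/
theorem inf_sup_eq_of_le_of_inf_eq_bot {L L' K : Subgroup Λ} (hinf : L ⊓ L' = ⊥) (hK : K ≤ L) :
    L ⊓ (K ⊔ L') = K := by
  refine le_antisymm ?_ (le_inf hK le_sup_left)
  rintro x ⟨hxL, hx⟩
  obtain ⟨k, hk, l', hl', rfl⟩ := Subgroup.mem_sup.mp hx
  have hl'L : l' ∈ L := by
    have := L.mul_mem (L.inv_mem (hK hk)) hxL
    rwa [inv_mul_cancel_left] at this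
  have hl'1 : l' = 1 := by
    have h : l' ∈ L ⊓ L' := ⟨hl'L, hl'⟩
    rw [hinf] at h
    exact h
  rw [hl'1, mul_one]
  exact hk

/-- In `Λ = L ⊕ L'` (abelian), `[Λ : K + L'] = [L : K]` for `K ≤ L` (bookkeeping for the ranks of
[CombGC] Rmk. 1.3.1). [cite: MochizukiCombGC2007, Rmk 1.3.1 p.10] -/
theorem index_sup_eq_of_isCompl {L L' K : Subgroup Λ} (hsup : L ⊔ L' = ⊤) (hinf : L ⊓ L' = ⊥)
    (hK : K ≤ L) : (K ⊔ L').index = K.relIndex L := by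
  have htop : L ⊔ (K ⊔ L') = ⊤ := top_le_iff.mp (hsup ▸ sup_le_sup_left le_sup_right L)
  rw [← Subgroup.relIndex_top_right, ← htop, Subgroup.relIndex_sup_right, ← Subgroup.inf_relIndex_left,
    inf_sup_eq_of_le_of_inf_eq_bot hinf hK]

end Abelian

/-! ### Restriction of a pro-`Σ` completion to a direct summand -/

namespace SemiGraphOfAnabelioids.IsProSigmaCompletion

open Literature.AnabelianGeometry.Anabelioids Topology

variable {Sigma : Set ℕ} {Λ : Type*} [CommGroup Λ] {A : Type*} [Group A] [TopologicalSpace A]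
  [IsTopologicalGroup A] [CompactSpace A] [TotallyDisconnectedSpace A] {ψ : Λ →* A}

omit [CompactSpace A] [TotallyDisconnectedSpace A] in
/-- The image of `x ∈ L` lies in the closure of `ψ(L)`. [cite: MochizukiSemiAnbd2006, Ex. 2.10 p.31] -/
theorem apply_mem_topologicalClosure_map (L : Subgroup Λ) (x : L) :
    ψ (x : Λ) ∈ (L.map ψ).topologicalClosure :=
  Subgroup.le_topologicalClosure _ ⟨x, x.2, rfl⟩

/-- **Pro-`Σ` completions restrict to direct summands.**  Let `ψ : Λ → A` be a pro-`Σ` completion of the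
abelian group `Λ` by the profinite pro-`Σ` group `A`, and `Λ = L ⊕ L'` (`L ⊔ L' = ⊤`, `L ⊓ L' = ⊥`).  Then
the co-restriction `ψ|_L : L → closure(ψ(L))` is a pro-`Σ` completion of `L` ("the closure of a direct
summand of rank `r` is free of rank `r` over `Ẑ^Σ`"). [cite: MochizukiCombGC2007, Rmk 1.3.1 p.10] -/
theorem restrict_summand (hψ : IsProSigmaCompletion Sigma ψ) (hA : IsProSigma Sigma A) (L L' : Subgroup Λ)
    (hsup : L ⊔ L' = ⊤) (hinf : L ⊓ L' = ⊥) :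
    IsProSigmaCompletion Sigma
      ((ψ.comp L.subtype).codRestrict (L.map ψ).topologicalClosure
        (fun x => apply_mem_topologicalClosure_map L x)) := by
  classical
  set B : Subgroup A := (L.map ψ).topologicalClosure with hB
  set ψL : L →* B := (ψ.comp L.subtype).codRestrict B (fun x => apply_mem_topologicalClosure_map L x)
    with hψL
  haveI : CompactSpace B := isCompact_iff_compactSpace.mp (Subgroup.isClosed_topologicalClosure _).isCompact
  have hψL_coe : ∀ x : L, ((ψL x : B) : A) = ψ (x : Λ) := fun _ => rfl
  refine ⟨?_, ?_, ?_⟩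
  · -- dense image
    intro b
    rw [IsEmbedding.subtypeVal.closure_eq_preimage_closure_image, Set.mem_preimage]
    have himg : Subtype.val '' Set.range ψL = ((L.map ψ : Subgroup A) : Set A) := by
      ext y
      constructor
      · rintro ⟨_, ⟨x, rfl⟩, rfl⟩
        exact ⟨x, x.2, (hψL_coe x).symm⟩
      · rintro ⟨x, hx, rfl⟩
        exact ⟨ψL ⟨x, hx⟩, ⟨⟨x, hx⟩, rfl⟩, hψL_coe ⟨x, hx⟩⟩
    rw [himg, ← Subgroup.topologicalClosure_coe]
    exact b.2
  · -- open subgroups of the closed subgroup `B` of the profinite pro-`Σ` group `A` have `Σ`-index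
    intro N _ hN
    exact (hA.subgroup B).isSigmaInteger_index N hN
  · -- a `Σ`-index `M ≤ L` is cut out by the open subgroup cutting out `M ⊕ L'`
    intro M _ hM
    set K : Subgroup Λ := M.map L.subtype with hK
    have hKL : K ≤ L := fun x hx => by obtain ⟨y, -, rfl⟩ := hx; exact y.2
    have hKM : K.subgroupOf L = M := Subgroup.comap_map_eq_self_of_injective L.subtype_injective M
    have hidx : (K ⊔ L').index = M.index := by
      rw [index_sup_eq_of_isCompl hsup hinf hKL, Subgroup.relIndex, hKM]
    obtain ⟨W, hWo, hWc⟩ := hψ.comap_surj (K ⊔ L') inferInstance (by rw [hidx]; exact hM)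
    refine ⟨W.comap B.subtype, hWo.preimage continuous_subtype_val, ?_⟩
    ext x
    rw [Subgroup.mem_comap, Subgroup.mem_comap, Subgroup.coe_subtype, hψL_coe, ← Subgroup.mem_comap, hWc]
    constructor
    · intro hx
      have hx' : (x : Λ) ∈ L ⊓ (K ⊔ L') := ⟨x.2, hx⟩
      rw [inf_sup_eq_of_le_of_inf_eq_bot hinf hKL] at hx'
      rw [← hKM, Subgroup.mem_subgroupOf]
      exact hx'
    · intro hx
      exact Subgroup.mem_sup_left ⟨x, hx, rfl⟩

end SemiGraphOfAnabelioids.IsProSigmaCompletion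

end Literature.AnabelianGeometry.SemiGraphs
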